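import Mathlib
import Summits.Ventures.PercRepro2.Defs
import Summits.Ventures.PercRepro2.Graph
import Summits.Ventures.PercRepro2.OneColourSwitch
import Summits.Ventures.PercRepro2.RegionHubSign
import Summits.Ventures.PercRepro2.SideSwitch
import Summits.Ventures.PercRepro2.TermSwitchDefs
import Summits.Ventures.PercRepro2.TermSwitchReach
import Summits.Ventures.PercRepro2.M9NoPocketDefs
import Summits.Ventures.PercRepro2.M9Unreached
import Summits.Ventures.PercRepro2.M9GeneralDSplit

/-!
# The hub–dead-end colourings, explicitly (blind cell PercRepro2, p3 g25, 2026-08-28;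
`proofs/P3-GENERALD.md` §2)

The `HD` colourings of `M9GeneralDSplit` are characterised without the terminal set
`{r, s, d}`: a colouring is `HD` iff it is `Sep ∧ DZero` (no doubly reached vertex at all), `d`
lies in exactly one world of `{r, s}`, and the cluster of `d` in the OTHER colour contains `p`,
`q` (a hub) or a vertex of the world of `d`'s colour other than `r, s, d` (a dead end):

  `HD ω ↔ Sep ω ∧ DZero ω ∧ ((d ∈ K₂ ∖ M₂ ∧ WDefect ω) ∨ (d ∈ M₂ ∖ K₂ ∧ YDefect ω))`

(`hd_iff`), with `WDefect ω := d ~_W p ∨ d ~_W q ∨ ∃ x ∉ {r, s, d}, x ∈ K₂ ∧ d ~_W x` and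
`YDefect` its colour mirror.  `HD` is invariant under the colour flip (`HD_compl`), which gives
the mirror of `hub_or_dead_of_HD_K` (`hub_or_dead_of_HD_M`).  This is the form in which the
conjecture `hdSum ≤ 0` (⟹ the general single-`d` statement, `dSignSum_nonpos_of_hdSum_nonpos`)
is a statement about the `Sep ∧ DZero` colourings alone.  Own work; std axioms.
-/

namespace Summit.Ventures.PercRepro2

namespace NoPocket

open Finset Classical RegionHub OneColourSwitch SideSwitch TermSwitch

variable {V : Type*} {E : Type*}

section Defect

variable {ends : E → Sym2 V} {p q r s d : V}

/-- The `W`-defect of `d`: its `W`-cluster contains `p`, `q`, or a vertex of `K₂` other than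
`r, s, d`. -/
def WDefect (ends : E → Sym2 V) (p q r s d : V) (ω : Config E) : Prop :=
  Conn ends (OneColourSwitch.compl ω) d p ∨ Conn ends (OneColourSwitch.compl ω) d q ∨
    ∃ x, x ≠ r ∧ x ≠ s ∧ x ≠ d ∧ x ∈ K2 ends r s ω ∧ Conn ends (OneColourSwitch.compl ω) d x

/-- The `Y`-defect of `d`: its `Y`-cluster contains `p`, `q`, or a vertex of `M₂` other than
`r, s, d`. -/
def YDefect (ends : E → Sym2 V) (p q r s d : V) (ω : Config E) : Prop :=
  Conn ends ω d p ∨ Conn ends ω d q ∨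
    ∃ x, x ≠ r ∧ x ≠ s ∧ x ≠ d ∧ x ∈ M2 ends r s ω ∧ Conn ends ω d x

/-- The `Y`-defect of the flipped colouring is the `W`-defect. -/
lemma YDefect_compl {ω : Config E} :
    YDefect ends p q r s d (OneColourSwitch.compl ω) ↔ WDefect ends p q r s d ω := by
  simp only [YDefect, WDefect, M2_compl]

/-- The `W`-defect of the flipped colouring is the `Y`-defect. -/
lemma WDefect_compl {ω : Config E} :
    WDefect ends p q r s d (OneColourSwitch.compl ω) ↔ YDefect ends p q r s d ω := by
  simp only [WDefect, YDefect, K2_compl, compl_compl]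

/-- `HD` is invariant under the colour flip. -/
lemma HD_compl {ω : Config E} :
    HD ends p q r s d (OneColourSwitch.compl ω) ↔ HD ends p q r s d ω := by
  rw [hd_iff_dzero, hd_iff_dzero, sep2_compl, sepH_compl, K2_compl, M2_compl]
  constructor
  · rintro ⟨hsep, hD, hone, hL⟩
    refine ⟨hsep, ?_, ?_, ?_⟩
    · have := DZero_compl hD
      rwa [compl_compl] at this
    · rcases hone with h | h
      · exact Or.inr h
      · exact Or.inl h
    · rintro ⟨h1, h2⟩
      exact hL ⟨h1, DZeroH_compl h2⟩
  · rintro ⟨hsep, hD, hone, hL⟩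
    refine ⟨hsep, DZero_compl hD, ?_, ?_⟩
    · rcases hone with h | h
      · exact Or.inr h
      · exact Or.inl h
    · rintro ⟨h1, h2⟩
      have := DZeroH_compl h2
      rw [compl_compl] at this
      exact hL ⟨h1, this⟩

/-- An `HD`-colouring with `d` in the `Y`-world has a `W`-defect. -/
lemma WDefect_of_HD_K {ω : Config E} (h : HD ends p q r s d ω) (hK : d ∈ K2 ends r s ω) :
    WDefect ends p q r s d ω :=
  hub_or_dead_of_HD_K h hK

/-- An `HD`-colouring with `d` in the `W`-world has a `Y`-defect (the colour mirror). -/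
lemma YDefect_of_HD_M {ω : Config E} (h : HD ends p q r s d ω) (hM : d ∈ M2 ends r s ω) :
    YDefect ends p q r s d ω := by
  have h' : HD ends p q r s d (OneColourSwitch.compl ω) := HD_compl.2 h
  have hK : d ∈ K2 ends r s (OneColourSwitch.compl ω) := by rw [K2_compl]; exact hM
  have := hub_or_dead_of_HD_K h' hK
  rwa [← WDefect, WDefect_compl] at this

/-- The mirror of `hub_or_dead_of_HD_K`, spelled out. -/
lemma hub_or_dead_of_HD_M {ω : Config E} (h : HD ends p q r s d ω) (hM : d ∈ M2 ends r s ω) :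
    Conn ends ω d p ∨ Conn ends ω d q ∨
      ∃ x, x ≠ r ∧ x ≠ s ∧ x ≠ d ∧ x ∈ M2 ends r s ω ∧ Conn ends ω d x :=
  YDefect_of_HD_M h hM

/-- A `W`-defect of `d` breaks `Sep_H ∧ DZero_H` for `H = {r, s, d}`: a hub puts `p` or `q`
into `M_H`, a dead end puts a vertex outside `H` into both worlds of `H`. -/
lemma not_L_of_WDefect {ω : Config E} (hW : WDefect ends p q r s d ω) :
    ¬ (sepH ends p q ({r, s, d} : Set V) ω ∧ DZeroH ends ({r, s, d} : Set V) ω) := by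
  rintro ⟨⟨_, _, hpM, hqM⟩, hD⟩
  rcases hW with h | h | ⟨x, hxr, hxs, hxd, hxK, hxc⟩
  · exact hpM (mem_MH_triple'.2 (Or.inr h))
  · exact hqM (mem_MH_triple'.2 (Or.inr h))
  · have hxH : x ∉ ({r, s, d} : Set V) := by
      simp only [Set.mem_insert_iff, Set.mem_singleton_iff, not_or]
      exact ⟨hxr, hxs, hxd⟩
    exact hD x hxH (K2_subset_KH (r_mem_triple r s d) (s_mem_triple r s d) ω hxK)
      (mem_MH_triple'.2 (Or.inr hxc))

/-- A `Y`-defect of `d` breaks `Sep_H ∧ DZero_H` for `H = {r, s, d}` (the colour mirror). -/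
lemma not_L_of_YDefect {ω : Config E} (hY : YDefect ends p q r s d ω) :
    ¬ (sepH ends p q ({r, s, d} : Set V) ω ∧ DZeroH ends ({r, s, d} : Set V) ω) := by
  have hW : WDefect ends p q r s d (OneColourSwitch.compl ω) := WDefect_compl.2 hY
  have := not_L_of_WDefect hW
  rintro ⟨h1, h2⟩
  exact this ⟨sepH_compl.2 h1, DZeroH_compl h2⟩

/-- **The `HD`-colourings, explicitly**: `Sep ∧ DZero`, `d` in exactly one world, and a defect of
`d` in the other colour. -/
theorem hd_iff {ω : Config E} :
    HD ends p q r s d ω ↔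
      sep2 ends p q r s ω ∧ DZero ends r s ω ∧
        ((d ∈ K2 ends r s ω ∧ d ∉ M2 ends r s ω ∧ WDefect ends p q r s d ω) ∨
          (d ∈ M2 ends r s ω ∧ d ∉ K2 ends r s ω ∧ YDefect ends p q r s d ω)) := by
  constructor
  · intro h
    obtain ⟨hsep, hD, hone, _⟩ := hd_iff_dzero.1 h
    refine ⟨hsep, hD, ?_⟩
    rcases hone with ⟨hK, hM⟩ | ⟨hM, hK⟩
    · exact Or.inl ⟨hK, hM, WDefect_of_HD_K h hK⟩
    · exact Or.inr ⟨hM, hK, YDefect_of_HD_M h hM⟩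
  · rintro ⟨hsep, hD, hone⟩
    rw [hd_iff_dzero]
    refine ⟨hsep, hD, ?_, ?_⟩
    · rcases hone with ⟨hK, hM, _⟩ | ⟨hM, hK, _⟩
      · exact Or.inl ⟨hK, hM⟩
      · exact Or.inr ⟨hM, hK⟩
    · rcases hone with ⟨_, _, hW⟩ | ⟨_, _, hY⟩
      · exact not_L_of_WDefect hW
      · exact not_L_of_YDefect hY

end Defect

end NoPocket

end Summit.Ventures.PercRepro2
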